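import Summits.AtomisticToContinuum.FouriersLaw.Theorems.BondHeatUncertaintySubdiffusiveBondHeatJunctionRatioCutoffCommutators
import Summits.AtomisticToContinuum.FouriersLaw.Theorems.BondHeatUncertaintySubdiffusiveBondHeatJunctionRatioResponseLink
import Summits.AtomisticToContinuum.FouriersLaw.Theorems.BondHeatUncertaintySubdiffusiveBondHeatJunctionRatioBracketGibbs

/-!
# [BI] — extension of the two weak identities to the tempered transfer class («BracketExtension», 24d)

Fourth file of the `[BI] ⟸ [EXT] ∧ [LINK]` chain for the residual
`Summit.AtomisticToContinuum.FouriersLaw.Theses.BondHeatUncertainty.BoundedResponse`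
(item `stmt-AtomisticToContinuum-11071`), door
`boundedResponse_of_bracket_of_peeled_of_escapeInfZero_of_subOhmicBootstrap′`, leaf [BI] =
`FirstBondBracket` (19b).  This file is the analytic step [EXT]: the two weak identities that [BI]
combines —

* the tap-score identity `∫ (g + a p_b) φ dμ_T = ∫ h · A_b φ dμ_T` (`IsTapScoreAt`, `φ ∈ C_c^∞`),
* the weak stationarity `∫ (L F) h dμ_T = c ∫ (p_0² − p_{N−1}²) F dμ_T` (24a, `F ∈ C_c^∞`),

are extended *jointly* from `C_c^∞` to the tempered smooth pair `(Ψ, G)` of the bracket (C3)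
`E = A_b Ψ − L G` (22b): testing with the energy cutoffs `χ_R Ψ`, `χ_R G` (`χ_R = χ(H/R)`) and
subtracting, the commutators `A_b(χ_R Ψ) − χ_R A_b Ψ` and `L(χ_R G) − χ_R L G` (24c) are `O(1/R)`
against the `L²` density `h` (§A), so `R → ∞` (dominated convergence, 24b) gives the
**paired extension**

  `∫ E h dμ_T = ∫ (g + a p_b) Ψ dμ_T − c ∫ (p_0² − p_{N−1}²) G dμ_T`.

Only `Ψ, G, ∂_{p_0}G, ∂_{p_{N−1}}G, E` need to be tempered — no bound on `A_b Ψ` or `L G`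
separately is used.  §B turns the paired extension into the moment identity
`τ_j = T ∫ Ψ g dμ_T + a T²` given (C3) with `E = p_j²/T − 1`, (G1a) `∫ (p_0² − p_{N−1}²) G dμ_T = 0`,
(G1b) `∫ p_b Ψ dμ_T = T` and [LINK] (24b); file 24e discharges the regularity at both bath ends
and proves `FirstBondBracket`.

No new definitions.  Written for the decomposition cell `decomp-a2c` (lens 1, g66).
-/

noncomputable section

open MeasureTheory Filter Topology Set
open scoped NNReal ENNReal ContDiff

namespace Summit.AtomisticToContinuum.FouriersLaw.Theorems.SubdiffusiveBondHeat.EscapeGrading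

open Literature.MathematicalPhysics.KineticTheory.HeatConduction
open Literature.Probability.Process Literature.MathematicalPhysics.KineticTheory OscillatorChain
open Summit.AtomisticToContinuum.FouriersLaw.Theorems.SubdiffusiveBondHeat.JunctionDefectGrading

variable {N : ℕ} {ω₂ lam β γ : ℝ}

/-! ## A. The paired cutoff extension -/

/-- **The `O(1/R)` defect.** With the data of `integral_bracket_mul_eq_of_weak` below, for `R ≥ 1`:
`|∫ h A_b(χ_RΨ) − ∫ L(χ_RG) h − ∫ χ_R E h| ≤ K/R`, where `K = ∫ M|h| dμ_T` for the tempered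
continuous weight `M = S₁|p_bΨ| + (|G|(γ(TS₂+S₁)(p_0²+p_{N−1}²)+2γTS₁) + 2γTS₁(|p_0∂_{p_0}G| + |p_{N−1}∂_{p_{N−1}}G|))`.
[analysis] -/
theorem exists_cutoff_defect_bound (hω : 0 < ω₂) (hl : 0 ≤ lam) (hβ : 0 ≤ β) (hγ : 0 ≤ γ) {T : ℝ}
    (hT : 0 < T) (hN : 0 < N) (b : Fin N) {h Ψ G E : PhaseSpace N → ℝ}
    (hh : MemLp h 2 ((pinnedChain ω₂ lam β γ).gibbsMeasure N T))
    (hΨ : ContDiff ℝ ((⊤ : ℕ∞) : WithTop ℕ∞) Ψ) (hΨt : IsTempered ω₂ lam β γ N Ψ)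
    (hG : ContDiff ℝ ((⊤ : ℕ∞) : WithTop ℕ∞) G) (hGt : IsTempered ω₂ lam β γ N G)
    (hG0 : IsTempered ω₂ lam β γ N (partialP ⟨0, hN⟩ G))
    (hG1 : IsTempered ω₂ lam β γ N (partialP ⟨N - 1, by omega⟩ G))
    (hEc : Continuous E) (hEt : IsTempered ω₂ lam β γ N E)
    (hC3 : ∀ x, E x = adjointP T b Ψ x - (pinnedChain ω₂ lam β γ).generator N T T G x) :
    ∃ K : ℝ, ∀ R : ℝ, 1 ≤ R →
      |(∫ x, h x * (x.2 b / T * (smoothCutoff ((pinnedChain ω₂ lam β γ).hamiltonian N x / R) * Ψ x)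
            - partialP b (fun y => smoothCutoff ((pinnedChain ω₂ lam β γ).hamiltonian N y / R) * Ψ y) x)
            ∂(pinnedChain ω₂ lam β γ).gibbsMeasure N T)
          - (∫ x, (pinnedChain ω₂ lam β γ).generator N T T
              (fun y => smoothCutoff ((pinnedChain ω₂ lam β γ).hamiltonian N y / R) * G y) x * h x
            ∂(pinnedChain ω₂ lam β γ).gibbsMeasure N T)
          - ∫ x, smoothCutoff ((pinnedChain ω₂ lam β γ).hamiltonian N x / R) * (E x * h x)
            ∂(pinnedChain ω₂ lam β γ).gibbsMeasure N T| ≤ K / R := by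
  haveI := pinnedChain_isProbabilityMeasure_gibbsMeasure hω hl hβ γ N hT
  have htop1 : ((⊤ : ℕ∞) : WithTop ℕ∞) + 1 ≤ ((⊤ : ℕ∞) : WithTop ℕ∞) := by exact_mod_cast le_top
  have htop2 : ((⊤ : ℕ∞) : WithTop ℕ∞) + 2 ≤ ((⊤ : ℕ∞) : WithTop ℕ∞) :=
    calc ((⊤ : ℕ∞) : WithTop ℕ∞) + 2 = (⊤ : ℕ∞) + 1 + 1 := by rw [add_assoc, one_add_one_eq_two]
      _ ≤ (⊤ : ℕ∞) + 1 := add_le_add_right htop1 1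
      _ ≤ (⊤ : ℕ∞) := htop1
  have h1top : (1 : WithTop ℕ∞) ≤ ((⊤ : ℕ∞) : WithTop ℕ∞) := by exact_mod_cast le_top
  have h2top : (2 : WithTop ℕ∞) ≤ ((⊤ : ℕ∞) : WithTop ℕ∞) := le_trans le_add_self htop2
  have h0top : ((⊤ : ℕ∞) : WithTop ℕ∞) ≠ 0 := (lt_of_lt_of_le zero_lt_one h1top).ne'
  obtain ⟨S₁, -, hS₁⟩ := exists_bound_deriv_smoothCutoff
  obtain ⟨S₂, -, hS₂⟩ := exists_bound_deriv_deriv_smoothCutoff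
  have hU := pinnedChain_contDiff_U ω₂ lam β γ (n := ∞)
  have hV := pinnedChain_contDiff_V ω₂ lam β γ (n := ∞)
  have hΨd : Differentiable ℝ Ψ := hΨ.differentiable h0top
  have hΨc : Continuous Ψ := hΨ.continuous
  have hG2 : ContDiff ℝ 2 G := hG.of_le h2top
  have hGc : Continuous G := hG.continuous
  have hLGc : Continuous ((pinnedChain ω₂ lam β γ).generator N T T G) :=
    (contDiff_generator_of_contDiff _ hU hV T T hG2 (m := 0) (by norm_num)).continuous
  have hG0c : Continuous (partialP ⟨0, hN⟩ G) := (contDiff_partialP hG htop1 _).continuous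
  have hG1c : Continuous (partialP ⟨N - 1, by omega⟩ G) := (contDiff_partialP hG htop1 _).continuous
  have hpc : ∀ k : Fin N, Continuous fun x : PhaseSpace N => x.2 k := fun k =>
    (continuous_apply k).comp continuous_snd
  -- the weight `M` and `K = ∫ M |h|`
  have hMc : Continuous fun x : PhaseSpace N => S₁ * |x.2 b * Ψ x|
      + (|G x| * (γ * (T * S₂ + S₁) * (x.2 ⟨0, hN⟩ ^ 2 + x.2 ⟨N - 1, by omega⟩ ^ 2) + 2 * γ * T * S₁)
        + 2 * γ * T * S₁ * (|x.2 ⟨0, hN⟩ * partialP ⟨0, hN⟩ G x|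
          + |x.2 ⟨N - 1, by omega⟩ * partialP ⟨N - 1, by omega⟩ G x|)) :=
    (continuous_const.mul ((hpc b).mul hΨc).abs).add
      ((hGc.abs.mul ((continuous_const.mul (((hpc _).pow 2).add ((hpc _).pow 2))).add
        continuous_const)).add
        (continuous_const.mul (((hpc _).mul hG0c).abs.add ((hpc _).mul hG1c).abs)))
  have H0 := hω.le
  have habs : ∀ {F : PhaseSpace N → ℝ}, IsTempered ω₂ lam β γ N F →
      IsTempered ω₂ lam β γ N fun x => |F x| := fun hF => hF.of_abs_le fun x => (abs_abs _).le
  have s := fun k : Fin N => IsTempered.snd (γ := γ) H0 hl hβ k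
  have hMt : IsTempered ω₂ lam β γ N fun x : PhaseSpace N => S₁ * |x.2 b * Ψ x|
      + (|G x| * (γ * (T * S₂ + S₁) * (x.2 ⟨0, hN⟩ ^ 2 + x.2 ⟨N - 1, by omega⟩ ^ 2) + 2 * γ * T * S₁)
        + 2 * γ * T * S₁ * (|x.2 ⟨0, hN⟩ * partialP ⟨0, hN⟩ G x|
          + |x.2 ⟨N - 1, by omega⟩ * partialP ⟨N - 1, by omega⟩ G x|)) :=
    ((habs ((s b).mul hΨt)).const_mul S₁).add H0 hl hβ
      (((habs hGt).mul (((((s _).pow 2).add H0 hl hβ ((s _).pow 2)).const_mul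
        (γ * (T * S₂ + S₁))).add H0 hl hβ (IsTempered.const _))).add H0 hl hβ
        (((habs ((s _).mul hG0)).add H0 hl hβ (habs ((s _).mul hG1))).const_mul (2 * γ * T * S₁)))
  have iMh : Integrable (fun x => (S₁ * |x.2 b * Ψ x|
      + (|G x| * (γ * (T * S₂ + S₁) * (x.2 ⟨0, hN⟩ ^ 2 + x.2 ⟨N - 1, by omega⟩ ^ 2) + 2 * γ * T * S₁)
        + 2 * γ * T * S₁ * (|x.2 ⟨0, hN⟩ * partialP ⟨0, hN⟩ G x|
          + |x.2 ⟨N - 1, by omega⟩ * partialP ⟨N - 1, by omega⟩ G x|))) * |h x|)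
      ((pinnedChain ω₂ lam β γ).gibbsMeasure N T) :=
    MemLp.integrable_mul (hMt.memLp_two hMc hω hl hβ hT) hh.abs
  have iEh : Integrable (fun x => E x * h x) ((pinnedChain ω₂ lam β γ).gibbsMeasure N T) :=
    MemLp.integrable_mul (hEt.memLp_two hEc hω hl hβ hT) hh
  refine ⟨∫ x, (S₁ * |x.2 b * Ψ x|
      + (|G x| * (γ * (T * S₂ + S₁) * (x.2 ⟨0, hN⟩ ^ 2 + x.2 ⟨N - 1, by omega⟩ ^ 2) + 2 * γ * T * S₁)
        + 2 * γ * T * S₁ * (|x.2 ⟨0, hN⟩ * partialP ⟨0, hN⟩ G x|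
          + |x.2 ⟨N - 1, by omega⟩ * partialP ⟨N - 1, by omega⟩ G x|))) * |h x|
      ∂(pinnedChain ω₂ lam β γ).gibbsMeasure N T, fun R hR => ?_⟩
  have hR0 : 0 < R := by linarith
  -- the pointwise defect
  have herr : ∀ x, |h x * (x.2 b / T * (smoothCutoff ((pinnedChain ω₂ lam β γ).hamiltonian N x / R) * Ψ x)
        - partialP b (fun y => smoothCutoff ((pinnedChain ω₂ lam β γ).hamiltonian N y / R) * Ψ y) x)
      - (pinnedChain ω₂ lam β γ).generator N T T
          (fun y => smoothCutoff ((pinnedChain ω₂ lam β γ).hamiltonian N y / R) * G y) x * h x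
      - smoothCutoff ((pinnedChain ω₂ lam β γ).hamiltonian N x / R) * (E x * h x)| ≤
      (S₁ * |x.2 b * Ψ x|
      + (|G x| * (γ * (T * S₂ + S₁) * (x.2 ⟨0, hN⟩ ^ 2 + x.2 ⟨N - 1, by omega⟩ ^ 2) + 2 * γ * T * S₁)
        + 2 * γ * T * S₁ * (|x.2 ⟨0, hN⟩ * partialP ⟨0, hN⟩ G x|
          + |x.2 ⟨N - 1, by omega⟩ * partialP ⟨N - 1, by omega⟩ G x|))) * |h x| / R := by
    intro x
    have eG := abs_generator_cutoff_mul_sub_le hN hγ hT.le hS₁ hS₂ hG2 hR x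
      (ω₂ := ω₂) (lam := lam) (β := β)
    rw [adjointP_cutoff_mul T R b hΨd x, hC3 x]
    simp only [adjointP]
    have e2 : h x * (smoothCutoff ((pinnedChain ω₂ lam β γ).hamiltonian N x / R) *
          (x.2 b / T * Ψ x - partialP b Ψ x)
          - Ψ x * (deriv smoothCutoff ((pinnedChain ω₂ lam β γ).hamiltonian N x / R) / R * x.2 b))
        - (pinnedChain ω₂ lam β γ).generator N T T
            (fun y => smoothCutoff ((pinnedChain ω₂ lam β γ).hamiltonian N y / R) * G y) x * h x
        - smoothCutoff ((pinnedChain ω₂ lam β γ).hamiltonian N x / R) *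
            ((x.2 b / T * Ψ x - partialP b Ψ x - (pinnedChain ω₂ lam β γ).generator N T T G x) * h x) =
        -(h x * (Ψ x * (deriv smoothCutoff ((pinnedChain ω₂ lam β γ).hamiltonian N x / R) / R * x.2 b)
          + ((pinnedChain ω₂ lam β γ).generator N T T
              (fun y => smoothCutoff ((pinnedChain ω₂ lam β γ).hamiltonian N y / R) * G y) x
            - smoothCutoff ((pinnedChain ω₂ lam β γ).hamiltonian N x / R) *
              (pinnedChain ω₂ lam β γ).generator N T T G x))) := by
      ring
    rw [e2, abs_neg, abs_mul]
    have e3 : |Ψ x * (deriv smoothCutoff ((pinnedChain ω₂ lam β γ).hamiltonian N x / R) / R * x.2 b)| ≤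
        S₁ * |x.2 b * Ψ x| / R := by
      have hD := hS₁ ((pinnedChain ω₂ lam β γ).hamiltonian N x / R)
      calc |Ψ x * (deriv smoothCutoff ((pinnedChain ω₂ lam β γ).hamiltonian N x / R) / R * x.2 b)|
            = |deriv smoothCutoff ((pinnedChain ω₂ lam β γ).hamiltonian N x / R)| * |x.2 b * Ψ x| / R := by
              rw [abs_mul, abs_mul, abs_mul, abs_div, abs_of_pos hR0]
              ring
        _ ≤ S₁ * |x.2 b * Ψ x| / R := by gcongr
    calc |h x| * |Ψ x * (deriv smoothCutoff ((pinnedChain ω₂ lam β γ).hamiltonian N x / R) / R * x.2 b)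
            + ((pinnedChain ω₂ lam β γ).generator N T T
                (fun y => smoothCutoff ((pinnedChain ω₂ lam β γ).hamiltonian N y / R) * G y) x
              - smoothCutoff ((pinnedChain ω₂ lam β γ).hamiltonian N x / R) *
                (pinnedChain ω₂ lam β γ).generator N T T G x)|
          ≤ |h x| * (S₁ * |x.2 b * Ψ x| / R
            + (|G x| * (γ * (T * S₂ + S₁) * (x.2 ⟨0, hN⟩ ^ 2 + x.2 ⟨N - 1, by omega⟩ ^ 2)
                + 2 * γ * T * S₁)
              + 2 * γ * T * S₁ * (|x.2 ⟨0, hN⟩ * partialP ⟨0, hN⟩ G x|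
                + |x.2 ⟨N - 1, by omega⟩ * partialP ⟨N - 1, by omega⟩ G x|)) / R) :=
            mul_le_mul_of_nonneg_left ((abs_add_le _ _).trans (add_le_add e3 eG)) (abs_nonneg _)
      _ = _ := by ring
  -- integrability of the three pieces
  have hχs : ContDiff ℝ ((⊤ : ℕ∞) : WithTop ℕ∞) fun y : PhaseSpace N =>
      smoothCutoff ((pinnedChain ω₂ lam β γ).hamiltonian N y / R) := pinnedChain_contDiff_cutoff N γ R
  have hχc : HasCompactSupport fun y : PhaseSpace N =>
      smoothCutoff ((pinnedChain ω₂ lam β γ).hamiltonian N y / R) :=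
    pinnedChain_hasCompactSupport_cutoff hω hl hβ N γ hR0
  have hφs : ContDiff ℝ ((⊤ : ℕ∞) : WithTop ℕ∞) fun y : PhaseSpace N =>
      smoothCutoff ((pinnedChain ω₂ lam β γ).hamiltonian N y / R) * Ψ y := hχs.mul hΨ
  have hφc : HasCompactSupport fun y : PhaseSpace N =>
      smoothCutoff ((pinnedChain ω₂ lam β γ).hamiltonian N y / R) * Ψ y := hχc.mul_right
  have hFs : ContDiff ℝ ((⊤ : ℕ∞) : WithTop ℕ∞) fun y : PhaseSpace N =>
      smoothCutoff ((pinnedChain ω₂ lam β γ).hamiltonian N y / R) * G y := hχs.mul hG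
  have hFc : HasCompactSupport fun y : PhaseSpace N =>
      smoothCutoff ((pinnedChain ω₂ lam β γ).hamiltonian N y / R) * G y := hχc.mul_right
  have hAc : Continuous fun x : PhaseSpace N =>
      x.2 b / T * (smoothCutoff ((pinnedChain ω₂ lam β γ).hamiltonian N x / R) * Ψ x)
        - partialP b (fun y => smoothCutoff ((pinnedChain ω₂ lam β γ).hamiltonian N y / R) * Ψ y) x :=
    (((hpc b).div_const T).mul hφs.continuous).sub (contDiff_partialP hφs htop1 b).continuous
  have hAcs : HasCompactSupport fun x : PhaseSpace N =>
      x.2 b / T * (smoothCutoff ((pinnedChain ω₂ lam β γ).hamiltonian N x / R) * Ψ x)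
        - partialP b (fun y => smoothCutoff ((pinnedChain ω₂ lam β γ).hamiltonian N y / R) * Ψ y) x :=
    hφc.mul_left.sub (hasCompactSupport_partialP (hφs.differentiable h0top) hφc b)
  have i1 : Integrable (fun x => h x *
      (x.2 b / T * (smoothCutoff ((pinnedChain ω₂ lam β γ).hamiltonian N x / R) * Ψ x)
        - partialP b (fun y => smoothCutoff ((pinnedChain ω₂ lam β γ).hamiltonian N y / R) * Ψ y) x))
      ((pinnedChain ω₂ lam β γ).gibbsMeasure N T) := by
    have i := integrable_mul_of_hasCompactSupport hω hl hβ hT hAc hAcs hh (γ := γ)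
    refine i.congr (ae_of_all _ fun x => ?_)
    simp only [mul_comm (h x)]
  have i2 : Integrable (fun x => (pinnedChain ω₂ lam β γ).generator N T T
      (fun y => smoothCutoff ((pinnedChain ω₂ lam β γ).hamiltonian N y / R) * G y) x * h x)
      ((pinnedChain ω₂ lam β γ).gibbsMeasure N T) :=
    integrable_mul_of_hasCompactSupport hω hl hβ hT
      (contDiff_generator_of_contDiff _ hU hV T T (hFs.of_le h2top) (m := 0) (by norm_num)).continuous
      ((pinnedChain ω₂ lam β γ).hasCompactSupport_generator N T T (hFs.of_le h2top) hFc) hh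
  have i3 : Integrable (fun x => smoothCutoff ((pinnedChain ω₂ lam β γ).hamiltonian N x / R) * (E x * h x))
      ((pinnedChain ω₂ lam β γ).gibbsMeasure N T) :=
    iEh.bdd_mul hχs.continuous.aestronglyMeasurable
      (ae_of_all _ fun x => by rw [Real.norm_eq_abs]; exact abs_cutoff_hamiltonian_le_one R x)
  have i12 : Integrable (fun x => h x *
      (x.2 b / T * (smoothCutoff ((pinnedChain ω₂ lam β γ).hamiltonian N x / R) * Ψ x)
        - partialP b (fun y => smoothCutoff ((pinnedChain ω₂ lam β γ).hamiltonian N y / R) * Ψ y) x)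
      - (pinnedChain ω₂ lam β γ).generator N T T
        (fun y => smoothCutoff ((pinnedChain ω₂ lam β γ).hamiltonian N y / R) * G y) x * h x)
      ((pinnedChain ω₂ lam β γ).gibbsMeasure N T) := i1.sub i2
  rw [← integral_sub i1 i2, ← integral_sub i12 i3]
  calc |∫ x, h x * (x.2 b / T * (smoothCutoff ((pinnedChain ω₂ lam β γ).hamiltonian N x / R) * Ψ x)
            - partialP b (fun y => smoothCutoff ((pinnedChain ω₂ lam β γ).hamiltonian N y / R) * Ψ y) x)
          - (pinnedChain ω₂ lam β γ).generator N T T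
              (fun y => smoothCutoff ((pinnedChain ω₂ lam β γ).hamiltonian N y / R) * G y) x * h x
          - smoothCutoff ((pinnedChain ω₂ lam β γ).hamiltonian N x / R) * (E x * h x)
          ∂(pinnedChain ω₂ lam β γ).gibbsMeasure N T|
        ≤ ∫ x, (S₁ * |x.2 b * Ψ x|
            + (|G x| * (γ * (T * S₂ + S₁) * (x.2 ⟨0, hN⟩ ^ 2 + x.2 ⟨N - 1, by omega⟩ ^ 2)
                + 2 * γ * T * S₁)
              + 2 * γ * T * S₁ * (|x.2 ⟨0, hN⟩ * partialP ⟨0, hN⟩ G x|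
                + |x.2 ⟨N - 1, by omega⟩ * partialP ⟨N - 1, by omega⟩ G x|))) * |h x| / R
          ∂(pinnedChain ω₂ lam β γ).gibbsMeasure N T := by
          rw [← Real.norm_eq_abs]
          exact norm_integral_le_of_norm_le (iMh.div_const R)
            (ae_of_all _ fun x => by rw [Real.norm_eq_abs]; exact herr x)
    _ = _ := integral_div R _

/-- **[EXT] The paired cutoff extension.** For the pinned chain (`ω₂ > 0`, `lam, β, γ ≥ 0`, `T > 0`,
`N ≥ 1`) let `h, g ∈ L²(μ_T)` satisfy the tap identity at site `b` with drive `a`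
(`∫ (g + a p_b) φ = ∫ h A_b φ`, all `φ ∈ C_c^∞`) and let `h` satisfy the weak stationarity
`∫ (L F) h = c ∫ (p_0² − p_{N−1}²) F` (all `F ∈ C_c^∞`).  If `Ψ, G ∈ C^∞` with
`Ψ, G, ∂_{p_0}G, ∂_{p_{N−1}}G` tempered and `E = A_b Ψ − L G` is continuous and tempered, then
`∫ E h dμ_T = ∫ (g + a p_b) Ψ dμ_T − c ∫ (p_0² − p_{N−1}²) G dμ_T`. [analysis] -/
theorem integral_bracket_mul_eq_of_weak (hω : 0 < ω₂) (hl : 0 ≤ lam) (hβ : 0 ≤ β) (hγ : 0 ≤ γ)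
    {T : ℝ} (hT : 0 < T) (hN : 0 < N) (b : Fin N) {a c : ℝ} {h g Ψ G E : PhaseSpace N → ℝ}
    (hh : MemLp h 2 ((pinnedChain ω₂ lam β γ).gibbsMeasure N T))
    (hg : MemLp g 2 ((pinnedChain ω₂ lam β γ).gibbsMeasure N T))
    (htap : ∀ φ : PhaseSpace N → ℝ, ContDiff ℝ ((⊤ : ℕ∞) : WithTop ℕ∞) φ → HasCompactSupport φ →
      ∫ x, (g x + a * x.2 b) * φ x ∂(pinnedChain ω₂ lam β γ).gibbsMeasure N T =
        ∫ x, h x * (x.2 b / T * φ x - partialP b φ x) ∂(pinnedChain ω₂ lam β γ).gibbsMeasure N T)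
    (hWL : ∀ F : PhaseSpace N → ℝ, ContDiff ℝ ((⊤ : ℕ∞) : WithTop ℕ∞) F → HasCompactSupport F →
      ∫ x, (pinnedChain ω₂ lam β γ).generator N T T F x * h x ∂(pinnedChain ω₂ lam β γ).gibbsMeasure N T =
        c * ∫ x, (x.2 ⟨0, hN⟩ ^ 2 - x.2 ⟨N - 1, by omega⟩ ^ 2) * F x
          ∂(pinnedChain ω₂ lam β γ).gibbsMeasure N T)
    (hΨ : ContDiff ℝ ((⊤ : ℕ∞) : WithTop ℕ∞) Ψ) (hΨt : IsTempered ω₂ lam β γ N Ψ)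
    (hG : ContDiff ℝ ((⊤ : ℕ∞) : WithTop ℕ∞) G) (hGt : IsTempered ω₂ lam β γ N G)
    (hG0 : IsTempered ω₂ lam β γ N (partialP ⟨0, hN⟩ G))
    (hG1 : IsTempered ω₂ lam β γ N (partialP ⟨N - 1, by omega⟩ G))
    (hEc : Continuous E) (hEt : IsTempered ω₂ lam β γ N E)
    (hC3 : ∀ x, E x = adjointP T b Ψ x - (pinnedChain ω₂ lam β γ).generator N T T G x) :
    ∫ x, E x * h x ∂(pinnedChain ω₂ lam β γ).gibbsMeasure N T =
      (∫ x, (g x + a * x.2 b) * Ψ x ∂(pinnedChain ω₂ lam β γ).gibbsMeasure N T)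
        - c * ∫ x, (x.2 ⟨0, hN⟩ ^ 2 - x.2 ⟨N - 1, by omega⟩ ^ 2) * G x
          ∂(pinnedChain ω₂ lam β γ).gibbsMeasure N T := by
  haveI := pinnedChain_isProbabilityMeasure_gibbsMeasure hω hl hβ γ N hT
  have hpc : ∀ k : Fin N, Continuous fun x : PhaseSpace N => x.2 k := fun k =>
    (continuous_apply k).comp continuous_snd
  have H0 := hω.le
  -- `L¹` facts for the three limits
  have iEh : Integrable (fun x => E x * h x) ((pinnedChain ω₂ lam β γ).gibbsMeasure N T) :=
    MemLp.integrable_mul (hEt.memLp_two hEc hω hl hβ hT) hh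
  have igΨ : Integrable (fun x => (g x + a * x.2 b) * Ψ x) ((pinnedChain ω₂ lam β γ).gibbsMeasure N T) := by
    have hga : MemLp (fun x : PhaseSpace N => g x + a * x.2 b) 2
        ((pinnedChain ω₂ lam β γ).gibbsMeasure N T) :=
      hg.add (((IsTempered.snd H0 hl hβ b).memLp_two (hpc b) hω hl hβ hT).const_mul a)
    exact MemLp.integrable_mul hga (hΨt.memLp_two hΨ.continuous hω hl hβ hT)
  have iwG : Integrable (fun x => (x.2 ⟨0, hN⟩ ^ 2 - x.2 ⟨N - 1, by omega⟩ ^ 2) * G x)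
      ((pinnedChain ω₂ lam β γ).gibbsMeasure N T) := by
    have hw : IsTempered ω₂ lam β γ N fun x : PhaseSpace N =>
        x.2 ⟨0, hN⟩ ^ 2 - x.2 ⟨N - 1, by omega⟩ ^ 2 :=
      ((IsTempered.snd H0 hl hβ _).pow 2).sub H0 hl hβ ((IsTempered.snd H0 hl hβ _).pow 2)
    exact MemLp.integrable_mul (hw.memLp_two (((hpc _).pow 2).sub ((hpc _).pow 2)) hω hl hβ hT)
      (hGt.memLp_two hG.continuous hω hl hβ hT)
  -- the defect bound and the three cutoff limits
  obtain ⟨K, hK⟩ := exists_cutoff_defect_bound hω hl hβ hγ hT hN b hh hΨ hΨt hG hGt hG0 hG1 hEc hEt hC3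
  have hv := tendsto_integral_cutoff_mul iEh (ω₂ := ω₂) (lam := lam) (β := β) (γ := γ)
  have hu := tendsto_of_abs_sub_le_div hv hK
  have hu' : Tendsto (fun R : ℝ =>
      (∫ x, h x * (x.2 b / T * (smoothCutoff ((pinnedChain ω₂ lam β γ).hamiltonian N x / R) * Ψ x)
          - partialP b (fun y => smoothCutoff ((pinnedChain ω₂ lam β γ).hamiltonian N y / R) * Ψ y) x)
          ∂(pinnedChain ω₂ lam β γ).gibbsMeasure N T)
        - ∫ x, (pinnedChain ω₂ lam β γ).generator N T T
            (fun y => smoothCutoff ((pinnedChain ω₂ lam β γ).hamiltonian N y / R) * G y) x * h x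
          ∂(pinnedChain ω₂ lam β γ).gibbsMeasure N T) atTop
      (𝓝 ((∫ x, (g x + a * x.2 b) * Ψ x ∂(pinnedChain ω₂ lam β γ).gibbsMeasure N T)
        - c * ∫ x, (x.2 ⟨0, hN⟩ ^ 2 - x.2 ⟨N - 1, by omega⟩ ^ 2) * G x
          ∂(pinnedChain ω₂ lam β γ).gibbsMeasure N T)) := by
    refine ((tendsto_integral_cutoff_mul igΨ).sub
      ((tendsto_integral_cutoff_mul iwG).const_mul c)).congr' ?_
    filter_upwards [eventually_gt_atTop (0 : ℝ)] with R hR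
    have hχs : ContDiff ℝ ((⊤ : ℕ∞) : WithTop ℕ∞) fun y : PhaseSpace N =>
        smoothCutoff ((pinnedChain ω₂ lam β γ).hamiltonian N y / R) := pinnedChain_contDiff_cutoff N γ R
    have hχc : HasCompactSupport fun y : PhaseSpace N =>
        smoothCutoff ((pinnedChain ω₂ lam β γ).hamiltonian N y / R) :=
      pinnedChain_hasCompactSupport_cutoff hω hl hβ N γ hR
    rw [← htap _ (hχs.mul hΨ) hχc.mul_right, hWL _ (hχs.mul hG) hχc.mul_right]
    congr 1
    · refine integral_congr_ae (ae_of_all _ fun x => ?_)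
      simp only
      ring
    · congr 1
      refine integral_congr_ae (ae_of_all _ fun x => ?_)
      simp only
      ring
  exact tendsto_nhds_unique hu hu'

/-! ## B. From the paired extension to the moment identity -/

/-- **The moment identity at a bath end** (abstract form of [BI]).  Let `h` be a response density,
`g` a tap score at site `b` with drive `a`, `τ` the moment coefficient of site `j`; let `Ψ, G` be as
in `integral_bracket_mul_eq_of_weak` with the bracket (C3) `p_j²/T − 1 = A_b Ψ − L G`, the Gibbs
orthogonality (G1a) `∫ (p_0² − p_{N−1}²) G dμ_T = 0` and the normalisation (G1b) `∫ p_b Ψ dμ_T = T`.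
Then `τ = T ∫ Ψ g dμ_T + a T²` ([EXT] above, weak stationarity 24a, [LINK] 24b). [assembly] -/
theorem momentCoefficient_eq_of_bracket (hω : 0 < ω₂) (hl : 0 < lam) (hβ : 0 < β) (hγ : 0 < γ)
    {T : ℝ} (hT : 0 < T) (hN : 1 ≤ N) {b j : Fin N} {a τ : ℝ} {h g Ψ G : PhaseSpace N → ℝ}
    (hh : IsResponseDensityAt ω₂ lam β γ T N h) (hg : IsTapScoreAt ω₂ lam β γ T N b a h g)
    (hτ : IsMomentCoefficientAt ω₂ lam β γ T N j τ)
    (hΨ : ContDiff ℝ ((⊤ : ℕ∞) : WithTop ℕ∞) Ψ) (hΨt : IsTempered ω₂ lam β γ N Ψ)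
    (hG : ContDiff ℝ ((⊤ : ℕ∞) : WithTop ℕ∞) G) (hGt : IsTempered ω₂ lam β γ N G)
    (hG0 : IsTempered ω₂ lam β γ N (partialP ⟨0, by omega⟩ G))
    (hG1 : IsTempered ω₂ lam β γ N (partialP ⟨N - 1, by omega⟩ G))
    (hC3 : ∀ x : PhaseSpace N, x.2 j ^ 2 / T - 1 =
      adjointP T b Ψ x - (pinnedChain ω₂ lam β γ).generator N T T G x)
    (hG1a : ∫ x, (x.2 ⟨0, by omega⟩ ^ 2 - x.2 ⟨N - 1, by omega⟩ ^ 2) * G x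
      ∂(pinnedChain ω₂ lam β γ).gibbsMeasure N T = 0)
    (hG1b : ∫ x, x.2 b * Ψ x ∂(pinnedChain ω₂ lam β γ).gibbsMeasure N T = T) :
    τ = T * ∫ x, Ψ x * g x ∂(pinnedChain ω₂ lam β γ).gibbsMeasure N T + a * T ^ 2 := by
  haveI := pinnedChain_isProbabilityMeasure_gibbsMeasure hω hl.le hβ.le γ N hT
  have hpc : ∀ k : Fin N, Continuous fun x : PhaseSpace N => x.2 k := fun k =>
    (continuous_apply k).comp continuous_snd
  have hEc : Continuous fun x : PhaseSpace N => x.2 j ^ 2 / T - 1 := by fun_prop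
  have hEt : IsTempered ω₂ lam β γ N fun x : PhaseSpace N => x.2 j ^ 2 / T - 1 :=
    IsTempered.of_eq ((((IsTempered.snd (γ := γ) hω.le hl.le hβ.le j).pow 2).mul
      (IsTempered.const T⁻¹)).sub hω.le hl.le hβ.le (IsTempered.const 1)) fun x => by ring
  have key := integral_bracket_mul_eq_of_weak hω hl.le hβ.le hγ.le hT (by omega) b hh.1 hg.1 hg.2
    (fun F hF hFc => integral_generator_mul_responseDensity_eq hω hl hβ hγ hT hN hh hF hFc)
    hΨ hΨt hG hGt hG0 hG1 hEc hEt hC3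
  rw [hG1a, mul_zero, sub_zero] at key
  -- left side: `∫ (p_j²/T − 1) h = τ/T`; right side: `∫ gΨ + aT`
  have hτ' := hτ.eq_integral_sq_mul hω hl hβ hγ hT hh
  have h0 := hh.integral_eq_zero hω hl hβ hγ hT (by omega)
  have ip : Integrable (fun x => x.2 j ^ 2 * h x) ((pinnedChain ω₂ lam β γ).gibbsMeasure N T) :=
    MemLp.integrable_mul (((IsTempered.snd hω.le hl.le hβ.le j).pow 2).memLp_two ((hpc j).pow 2)
      hω hl.le hβ.le hT) hh.1
  have ih : Integrable h ((pinnedChain ω₂ lam β γ).gibbsMeasure N T) := hh.1.integrable one_le_two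
  have hL : ∫ x, (x.2 j ^ 2 / T - 1) * h x ∂(pinnedChain ω₂ lam β γ).gibbsMeasure N T = τ / T := by
    have e : ∀ x : PhaseSpace N, (x.2 j ^ 2 / T - 1) * h x = T⁻¹ * (x.2 j ^ 2 * h x) - h x := fun x => by
      ring
    simp only [e]
    rw [integral_sub (ip.const_mul _) ih, integral_const_mul, ← hτ', h0]
    ring
  have igΨ : Integrable (fun x => g x * Ψ x) ((pinnedChain ω₂ lam β γ).gibbsMeasure N T) :=
    MemLp.integrable_mul hg.1 (hΨt.memLp_two hΨ.continuous hω hl.le hβ.le hT)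
  have ipΨ : Integrable (fun x => x.2 b * Ψ x) ((pinnedChain ω₂ lam β γ).gibbsMeasure N T) :=
    MemLp.integrable_mul ((IsTempered.snd hω.le hl.le hβ.le b).memLp_two (hpc b) hω hl.le hβ.le hT)
      (hΨt.memLp_two hΨ.continuous hω hl.le hβ.le hT)
  have hR : ∫ x, (g x + a * x.2 b) * Ψ x ∂(pinnedChain ω₂ lam β γ).gibbsMeasure N T =
      (∫ x, Ψ x * g x ∂(pinnedChain ω₂ lam β γ).gibbsMeasure N T) + a * T := by
    have e : ∀ x : PhaseSpace N, (g x + a * x.2 b) * Ψ x = g x * Ψ x + a * (x.2 b * Ψ x) := fun x => by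
      ring
    simp only [e]
    rw [integral_add igΨ (ipΨ.const_mul a), integral_const_mul, hG1b]
    congr 1
    exact integral_congr_ae (ae_of_all _ fun x => mul_comm _ _)
  rw [hL, hR] at key
  field_simp at key
  linear_combination key

end Summit.AtomisticToContinuum.FouriersLaw.Theorems.SubdiffusiveBondHeat.EscapeGrading

end
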